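import Summits.CriticalPhenomena.PercolationContinuityZ3.Theorems.PercBurnResprinkleUniformDiminishmentModel

/-!
# Uniform diminishment on `ℤ³` (3/8): the surgery, abstractly

Helper file for item `stmt-CriticalPhenomena-7206` (`PercBurnResprinkle.UniformDiminishment`, the quenched,
uniform Aizenman–Grimmett diminishment on `ℤ³`), landed with `--supports stmt-CriticalPhenomena-7206`.
The proof runs the in-tree Aizenman–Grimmett engine (`Literature.Probability.Percolation.AGLine`, after
Martineau–Severo 2019 §6) for the two-parameter model "edges open with probability `p`, points of the
thinned deleted set restored with probability `s`"; no definitions are introduced — the available-edge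
map `av` and the exit event `A` enter through characterising hypotheses (`hav`, `hA`).

Contents: given a pivotal edge `e` of the exit event, a deleted vertex `d`, a region `Q ∋ d` touching `e`
with `Q ∩ D ⊆ {d}`, disjoint linking sets `Xa, Xb ⊆ Q ∖ {d}` and connector edges, the modified
configuration (edges meeting `Q` closed, lattice edges inside `insert d Xa` / `insert d Xb` and the
connectors opened, marks untouched) has the mark of `d` pivotal (`exists_pivotal_config`): with `d`
deleted the cluster of `o` stays inside `C ∪ Xa ⊆ o + box r` (`not_mem_event_of_surgery`), with `d`
restored it reaches a far vertex (`mem_event_of_surgery`).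
-/

namespace Summit.CriticalPhenomena.PercolationContinuityZ3.Theorems

open Literature.Probability.Percolation Literature.Probability.LatticeModels

namespace UnifDim

/-! ### The surgery, abstractly: a restored vertex made pivotal

Fix a pivotal edge `e` of the exit event `A` at `ξ`, a deleted vertex `d ∈ D` and a region `Q ∋ d`
touching `e` and containing no other point of `D`. The modified configuration `ξ'` closes every edge
meeting `Q`, opens all lattice edges inside `insert d Xa` and inside `insert d Xb` for two disjoint
vertex sets `Xa, Xb ⊆ Q ∖ {d}` (`Xa` inside the box `o + box r`), and re-opens some connector edges
`Conn`; marks are untouched. The two lemmas below give the two halves of "`d` is pivotal at `ξ'`". -/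

section Surgery

variable {D : Set (Site 3)} {av : Set (Sym2 (Site 3) ⊕ Site 3) → Set (Sym2 (Site 3))}
  {A : Set (Set (Sym2 (Site 3) ⊕ Site 3))} {o : Site 3} {r : ℕ}

/-- No available edge of the configuration "`ξ⁺` with all edges meeting `Q` closed" has an endpoint
in `Q`; hence its cluster at `o` meets `Q` at most in `o`. -/
theorem eq_of_reachable_closed
    (hav : ∀ ξ f, f ∈ av ξ ↔ Sum.inl f ∈ ξ ∧ f ∈ (zdGraph 3).edgeSet ∧ ∀ y ∈ f, y ∈ D → Sum.inr y ∈ ξ)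
    {ξ : Set (Sym2 (Site 3) ⊕ Site 3)} {e : Sym2 (Site 3)} {Q : Set (Site 3)} {u : Site 3}
    (hu : (openGraph (av (insert (Sum.inl e) ξ \ Sum.inl '' {f | ∃ y ∈ f, y ∈ Q}))).Reachable o u)
    (huQ : u ∈ Q) : u = o := by
  obtain ⟨w⟩ := hu.symm
  cases w with
  | nil => rfl
  | cons h _ =>
    exfalso
    obtain ⟨hmem, -⟩ := (openGraph_adj _ _ _).1 h
    rw [hav] at hmem
    obtain ⟨⟨-, hnot⟩, -, -⟩ := hmem
    exact hnot ⟨_, ⟨u, Sym2.mem_mk_left _ _, huQ⟩, rfl⟩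

/-- The closed configuration lies below `ξ⁻ = ξ ∖ {e}` when `e` meets `Q`; so if `ξ⁻ ∉ A`, its cluster
at `o` stays inside `o + box r`. -/
theorem mem_box_of_reachable_closed
    (hav : ∀ ξ f, f ∈ av ξ ↔ Sum.inl f ∈ ξ ∧ f ∈ (zdGraph 3).edgeSet ∧ ∀ y ∈ f, y ∈ D → Sum.inr y ∈ ξ)
    (hA : ∀ ξ, ξ ∈ A ↔ ∃ v, (openGraph (av ξ)).Reachable o v ∧ v - o ∉ box 3 r)
    {ξ : Set (Sym2 (Site 3) ⊕ Site 3)} {e : Sym2 (Site 3)} {Q : Set (Site 3)}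
    (hm : ξ \ {Sum.inl e} ∉ A) (he : ∃ y ∈ e, y ∈ Q) {u : Site 3}
    (hu : (openGraph (av (insert (Sum.inl e) ξ \ Sum.inl '' {f | ∃ y ∈ f, y ∈ Q}))).Reachable o u) :
    u - o ∈ box 3 r := by
  by_contra hfar
  refine hm ((hA _).2 ⟨u, reachable_openGraph_mono (av_mono hav ?_) hu, hfar⟩)
  rintro i ⟨hi, hnot⟩
  refine ⟨?_, ?_⟩
  · rcases hi with rfl | hi
    · exact absurd ⟨e, he, rfl⟩ hnot
    · exact hi
  · rintro rfl
    exact hnot ⟨e, he, rfl⟩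

/-- Vertices reachable from `o` in a graph all lie in any set containing `o` and closed under
adjacency from inside. -/
theorem mem_of_reachable_of_closed {V : Type*} {H : SimpleGraph V} {X : Set V} {o v : V}
    (ho : o ∈ X) (hX : ∀ u v, u ∈ X → H.Adj u v → v ∈ X) (h : H.Reachable o v) : v ∈ X := by
  obtain ⟨w⟩ := h
  suffices key : ∀ (a b : V) (w : H.Walk a b), a ∈ X → b ∈ X from key o v w ho
  intro a b w
  induction w with
  | nil => exact id
  | @cons x y z hxy _ ih => exact fun hx => ih (hX x y hx hxy)

/-- **Surgery, first half: with `d` deleted the event fails.** In the modified configuration with the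
mark of `d` removed, every vertex reachable from `o` lies in `C ∪ Xa`, where `C` is the cluster of `o`
in the closed configuration (inside `o + box r` since `ξ⁻ ∉ A`) and `Xa ⊆ o + box r`. -/
theorem not_mem_event_of_surgery
    (hav : ∀ ξ f, f ∈ av ξ ↔ Sum.inl f ∈ ξ ∧ f ∈ (zdGraph 3).edgeSet ∧ ∀ y ∈ f, y ∈ D → Sum.inr y ∈ ξ)
    (hA : ∀ ξ, ξ ∈ A ↔ ∃ v, (openGraph (av ξ)).Reachable o v ∧ v - o ∉ box 3 r)
    {ξ ξ' : Set (Sym2 (Site 3) ⊕ Site 3)} {e : Sym2 (Site 3)} {Q Xa Xb : Set (Site 3)} {d : Site 3}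
    {Conn : Set (Sym2 (Site 3))}
    (hm : ξ \ {Sum.inl e} ∉ A) (he : ∃ y ∈ e, y ∈ Q) (hdD : d ∈ D)
    (hXab : Disjoint Xa Xb) (hdXb : d ∉ Xb) (hXaQ : Xa ⊆ Q) (hXbQ : Xb ⊆ Q)
    (hXaN : ∀ v ∈ Xa, v - o ∈ box 3 r) (ho : o ∈ Q → o = d ∨ o ∈ Xa)
    (hConn : ∀ f ∈ Conn,
      (∀ y ∈ f, (openGraph (av (insert (Sum.inl e) ξ \ Sum.inl '' {f | ∃ y ∈ f, y ∈ Q}))).Reachable o y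
        ∨ y ∈ Xa) ∨
      (∀ y ∈ f, ¬ ((openGraph (av (insert (Sum.inl e) ξ \ Sum.inl '' {f | ∃ y ∈ f, y ∈ Q}))).Reachable o y
        ∨ y ∈ Xa)))
    (hξ'E : ∀ f, Sum.inl f ∈ ξ' ↔
      (Sum.inl f ∈ insert (Sum.inl e) ξ ∧ ¬ ∃ y ∈ f, y ∈ Q) ∨
      (f ∈ (zdGraph 3).edgeSet ∧ ∀ y ∈ f, y ∈ insert d Xa) ∨
      (f ∈ (zdGraph 3).edgeSet ∧ ∀ y ∈ f, y ∈ insert d Xb) ∨ f ∈ Conn)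
    (hξ'V : ∀ y, Sum.inr y ∈ ξ' ↔ Sum.inr y ∈ ξ) :
    ξ' \ {Sum.inr d} ∉ A := by
  classical
  set ξt : Set (Sym2 (Site 3) ⊕ Site 3) := insert (Sum.inl e) ξ \ Sum.inl '' {f | ∃ y ∈ f, y ∈ Q}
    with hξt
  set X : Set (Site 3) := {y | (openGraph (av ξt)).Reachable o y ∨ y ∈ Xa} with hX
  -- no vertex of `X` is far
  have hXfar : ∀ y ∈ X, y - o ∈ box 3 r := by
    rintro y (hy | hy)
    · exact mem_box_of_reachable_closed hav hA hm he hy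
    · exact hXaN y hy
  -- `X` is closed under available edges of `ξ' ∖ {d}`
  have hclosed : ∀ u v, u ∈ X → (openGraph (av (ξ' \ {Sum.inr d}))).Adj u v → v ∈ X := by
    intro u v hu huv
    obtain ⟨hf, huv_ne⟩ := (openGraph_adj _ _ _).1 huv
    rw [hav] at hf
    obtain ⟨hin, hE, hmarks⟩ := hf
    -- neither endpoint is `d`
    have hnd : ∀ y ∈ s(u, v), y ≠ d := by
      rintro y hy rfl
      exact (hmarks y hy hdD).2 rfl
    have hud : u ≠ d := hnd u (Sym2.mem_mk_left u v)
    have hvd : v ≠ d := hnd v (Sym2.mem_mk_right u v)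
    have hmarks' : ∀ y ∈ s(u, v), y ∈ D → Sum.inr y ∈ ξ := fun y hy hyD =>
      (hξ'V y).1 (hmarks y hy hyD).1
    rcases (hξ'E _).1 hin.1 with ⟨hin', hnQ⟩ | ⟨-, hXa'⟩ | ⟨-, hXb'⟩ | hC
    · -- an old edge away from `Q`: both endpoints outside `Q`, so `u ∈ C` and the edge is available in `ξt`
      have huQ : u ∉ Q := fun h => hnQ ⟨u, Sym2.mem_mk_left u v, h⟩
      have huC : (openGraph (av ξt)).Reachable o u := by
        rcases hu with hu | hu
        · exact hu
        · exact absurd (hXaQ hu) huQ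
      left
      refine huC.trans (SimpleGraph.Adj.reachable ((openGraph_adj _ _ _).2 ⟨?_, huv_ne⟩))
      rw [hav]
      refine ⟨⟨hin', fun ⟨f, hf, hfe⟩ => hnQ ?_⟩, hE, fun y hy hyD => ⟨?_, ?_⟩⟩
      · rw [Sum.inl_injective hfe] at hf; exact hf
      · exact Set.mem_insert_of_mem _ (hmarks' y hy hyD)
      · rintro ⟨f, -, hf⟩; exact Sum.inl_ne_inr hf
    · -- an edge inside `insert d Xa`
      right
      have := hXa' v (Sym2.mem_mk_right u v)
      rcases this with rfl | hv
      · exact absurd rfl hvd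
      · exact hv
    · -- an edge inside `insert d Xb`: impossible, `u ∉ Xb`
      exfalso
      have huXb : u ∈ Xb := by
        rcases hXb' u (Sym2.mem_mk_left u v) with rfl | h
        · exact absurd rfl hud
        · exact h
      rcases hu with hu | hu
      · have huo : u = o := eq_of_reachable_closed hav hu (hXbQ huXb)
        subst huo
        rcases ho (hXbQ huXb) with h | h
        · exact hud h
        · exact Set.disjoint_left.1 hXab h huXb
      · exact Set.disjoint_left.1 hXab hu huXb
    · -- a connector
      rcases hConn _ hC with h | h
      · exact h v (Sym2.mem_mk_right u v)
      · exact absurd hu (h u (Sym2.mem_mk_left u v))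
  -- conclusion
  intro hA'
  rw [hA] at hA'
  obtain ⟨v, hv, hfar⟩ := hA'
  have ho' : o ∈ X := Or.inl SimpleGraph.Reachable.rfl
  exact hfar (hXfar v (mem_of_reachable_of_closed ho' hclosed hv))

/-- **Surgery, second half: with `d` restored the event holds.** Hypotheses: the link from `o` into
`insert d Xa` (trivial if `o ∈ insert d Xa`, else an available path of `ξ⁺` avoiding `Q` followed by a
connector edge), lattice connections `a ↝ d` inside `insert d Xa` and `d ↝ t` inside `insert d Xb`,
and either `t` is far or a connector edge at `t` followed by an available path of `ξ⁺` avoiding `Q`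
to a far vertex. -/
theorem mem_event_of_surgery
    (hav : ∀ ξ f, f ∈ av ξ ↔ Sum.inl f ∈ ξ ∧ f ∈ (zdGraph 3).edgeSet ∧ ∀ y ∈ f, y ∈ D → Sum.inr y ∈ ξ)
    (hA : ∀ ξ, ξ ∈ A ↔ ∃ v, (openGraph (av ξ)).Reachable o v ∧ v - o ∉ box 3 r)
    {ξ ξ' : Set (Sym2 (Site 3) ⊕ Site 3)} {e : Sym2 (Site 3)} {Q Xa Xb : Set (Site 3)} {d a t : Site 3}
    {Conn : Set (Sym2 (Site 3))}
    (hQD : ∀ y ∈ Q, y ∈ D → y = d) (hdQ : d ∈ Q) (hXaQ : Xa ⊆ Q) (hXbQ : Xb ⊆ Q)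
    (hConn : Conn ⊆ av (insert (Sum.inl e) ξ))
    (hξ'E : ∀ f, Sum.inl f ∈ ξ' ↔
      (Sum.inl f ∈ insert (Sum.inl e) ξ ∧ ¬ ∃ y ∈ f, y ∈ Q) ∨
      (f ∈ (zdGraph 3).edgeSet ∧ ∀ y ∈ f, y ∈ insert d Xa) ∨
      (f ∈ (zdGraph 3).edgeSet ∧ ∀ y ∈ f, y ∈ insert d Xb) ∨ f ∈ Conn)
    (hξ'V : ∀ y, Sum.inr y ∈ ξ' ↔ Sum.inr y ∈ ξ)
    (halink : o = d ∨ o = a ∨ ∃ a₀, (∃ w : (openGraph (av (insert (Sum.inl e) ξ))).Walk o a₀,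
      ∀ z ∈ w.support, z ∉ Q) ∧ s(a₀, a) ∈ Conn)
    (ha : (siteOpenGraph (zdGraph 3) (insert d Xa)).Reachable a d)
    (ht : (siteOpenGraph (zdGraph 3) (insert d Xb)).Reachable d t)
    (htlink : t - o ∉ box 3 r ∨ ∃ t₁, s(t, t₁) ∈ Conn ∧ ∃ v, v - o ∉ box 3 r ∧
      ∃ w : (openGraph (av (insert (Sum.inl e) ξ))).Walk t₁ v, ∀ z ∈ w.support, z ∉ Q) :
    insert (Sum.inr d) ξ' ∈ A := by
  classical
  set ξp : Set (Sym2 (Site 3) ⊕ Site 3) := insert (Sum.inl e) ξ with hξp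
  set H : SimpleGraph (Site 3) := openGraph (av (insert (Sum.inr d) ξ')) with hH
  -- marks of `ξ⁺` persist
  have hmark : ∀ y, Sum.inr y ∈ ξp → Sum.inr y ∈ insert (Sum.inr d) ξ' := by
    intro y hy
    rcases hy with h | h
    · exact absurd h Sum.inr_ne_inl
    · exact Set.mem_insert_of_mem _ ((hξ'V y).2 h)
  -- (S1) available walks of `ξ⁺` avoiding `Q` survive
  have S1 : ∀ {u v : Site 3} (w : (openGraph (av ξp)).Walk u v), (∀ z ∈ w.support, z ∉ Q) →
      H.Reachable u v := by
    intro u v w hw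
    refine reachable_openGraph_of_edges w fun f hf => ?_
    have hfav : f ∈ av ξp := mem_of_mem_edges_openGraph w hf
    rw [hav] at hfav ⊢
    obtain ⟨hin, hE, hmarks⟩ := hfav
    refine ⟨Set.mem_insert_of_mem _ ((hξ'E f).2 (Or.inl ⟨hin, ?_⟩)), hE,
      fun y hy hyD => hmark y (hmarks y hy hyD)⟩
    rintro ⟨y, hy, hyQ⟩
    exact hw y (mem_support_of_mem_edges w hf hy) hyQ
  -- (S2) connectors survive
  have S2 : ∀ {u v : Site 3}, s(u, v) ∈ Conn → H.Reachable u v := by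
    intro u v huv
    have hfav : s(u, v) ∈ av ξp := hConn huv
    rw [hav] at hfav
    obtain ⟨-, hE, hmarks⟩ := hfav
    refine SimpleGraph.Adj.reachable ((openGraph_adj _ _ _).2 ⟨?_, ?_⟩)
    · rw [hav]
      exact ⟨Set.mem_insert_of_mem _ ((hξ'E _).2 (Or.inr (Or.inr (Or.inr huv)))), hE,
        fun y hy hyD => hmark y (hmarks y hy hyD)⟩
    · exact ((SimpleGraph.mem_edgeSet (zdGraph 3)).1 hE).ne
  -- (S3) lattice moves inside `insert d Xa` / `insert d Xb` are available
  have S3 : ∀ (X : Set (Site 3)), X ⊆ Q →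
      (∀ f, f ∈ (zdGraph 3).edgeSet → (∀ y ∈ f, y ∈ insert d X) → Sum.inl f ∈ ξ') →
      ∀ {u v : Site 3}, (siteOpenGraph (zdGraph 3) (insert d X)).Reachable u v → H.Reachable u v := by
    intro X hXQ hopen u v huv
    refine huv.mono ?_
    intro x y hxy
    rw [siteOpenGraph_adj] at hxy
    obtain ⟨hG, hx, hy⟩ := hxy
    refine (openGraph_adj _ _ _).2 ⟨?_, hG.ne⟩
    rw [hav]
    have hends : ∀ z ∈ s(x, y), z ∈ insert d X := by
      intro z hz
      rcases Sym2.mem_iff.1 hz with rfl | rfl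
      · exact hx
      · exact hy
    refine ⟨Set.mem_insert_of_mem _ (hopen _ hG hends), hG, fun z hz hzD => ?_⟩
    have hzQ : z ∈ Q := by
      rcases hends z hz with rfl | h
      · exact hdQ
      · exact hXQ h
    rw [hQD z hzQ hzD]
    exact Set.mem_insert _ _
  have S3a : ∀ {u v : Site 3}, (siteOpenGraph (zdGraph 3) (insert d Xa)).Reachable u v → H.Reachable u v :=
    S3 Xa hXaQ fun f hf hends => (hξ'E f).2 (Or.inr (Or.inl ⟨hf, hends⟩))
  have S3b : ∀ {u v : Site 3}, (siteOpenGraph (zdGraph 3) (insert d Xb)).Reachable u v → H.Reachable u v :=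
    S3 Xb hXbQ fun f hf hends => (hξ'E f).2 (Or.inr (Or.inr (Or.inl ⟨hf, hends⟩)))
  -- assemble the path `o ↝ d ↝ t ↝ far`
  have hod : H.Reachable o d := by
    rcases halink with rfl | rfl | ⟨a₀, ⟨w, hw⟩, hconn⟩
    · rfl
    · exact S3a ha
    · exact ((S1 w hw).trans (S2 hconn)).trans (S3a ha)
  have hot : H.Reachable o t := hod.trans (S3b ht)
  rw [hA]
  rcases htlink with hfar | ⟨t₁, hconn, v, hvfar, w, hw⟩
  · exact ⟨t, hot, hfar⟩
  · exact ⟨v, hot.trans ((S2 hconn).trans (S1 w hw)), hvfar⟩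


/-- An available walk of `ξ⁺` avoiding `Q` is an available walk of the closed configuration. -/
theorem reachable_closed_of_walk_avoiding
    (hav : ∀ ξ f, f ∈ av ξ ↔ Sum.inl f ∈ ξ ∧ f ∈ (zdGraph 3).edgeSet ∧ ∀ y ∈ f, y ∈ D → Sum.inr y ∈ ξ)
    {ξ : Set (Sym2 (Site 3) ⊕ Site 3)} {e : Sym2 (Site 3)} {Q : Set (Site 3)} {u v : Site 3}
    (w : (openGraph (av (insert (Sum.inl e) ξ))).Walk u v) (hw : ∀ z ∈ w.support, z ∉ Q) :
    (openGraph (av (insert (Sum.inl e) ξ \ Sum.inl '' {f | ∃ y ∈ f, y ∈ Q}))).Reachable u v := by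
  refine reachable_openGraph_of_edges w fun f hf => ?_
  have hfav : f ∈ av (insert (Sum.inl e) ξ) := mem_of_mem_edges_openGraph w hf
  rw [hav] at hfav ⊢
  obtain ⟨hin, hE, hmarks⟩ := hfav
  refine ⟨⟨hin, ?_⟩, hE, fun y hy hyD => ⟨hmarks y hy hyD, ?_⟩⟩
  · rintro ⟨f', ⟨y, hy, hyQ⟩, hff'⟩
    rw [Sum.inl_injective hff'] at hy
    exact hw y (mem_support_of_mem_edges w hf hy) hyQ
  · rintro ⟨f', -, hff'⟩
    exact Sum.inl_ne_inr hff'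

/-- **The surgery assembled.** From the linking data (sets `Xa, Xb`, connectors `Conn`, entrance `a`,
target `t`) build the modified configuration and conclude: it agrees with `ξ` on marks and on edges
away from `Q`, and the deleted vertex `d` is pivotal in it. -/
theorem exists_pivotal_config
    (hav : ∀ ξ f, f ∈ av ξ ↔ Sum.inl f ∈ ξ ∧ f ∈ (zdGraph 3).edgeSet ∧ ∀ y ∈ f, y ∈ D → Sum.inr y ∈ ξ)
    (hA : ∀ ξ, ξ ∈ A ↔ ∃ v, (openGraph (av ξ)).Reachable o v ∧ v - o ∉ box 3 r)
    {ξ : Set (Sym2 (Site 3) ⊕ Site 3)} {x x' : Site 3} {Q Xa Xb : Set (Site 3)} {d a t : Site 3}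
    {Conn : Set (Sym2 (Site 3))} {ρ₂ : ℕ}
    (hm : ξ \ {Sum.inl s(x, x')} ∉ A) (hxQ : x ∈ Q) (hdD : d ∈ D) (hdQ : d ∈ Q)
    (hQD : ∀ y ∈ Q, y ∈ D → y = d) (hQx : ∀ y ∈ Q, y - x ∈ box 3 ρ₂)
    (hXab : Disjoint Xa Xb) (hdXb : d ∉ Xb) (hXaQ : Xa ⊆ Q) (hXbQ : Xb ⊆ Q)
    (hXaN : ∀ v ∈ Xa, v - o ∈ box 3 r) (ho : o ∈ Q → o = d ∨ o ∈ Xa)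
    (hConnQ : ∀ f ∈ Conn, ∃ y ∈ f, y ∈ Q) (hConnav : Conn ⊆ av (insert (Sum.inl s(x, x')) ξ))
    (hConn : ∀ f ∈ Conn,
      (∀ y ∈ f, (openGraph (av (insert (Sum.inl s(x, x')) ξ \ Sum.inl '' {f | ∃ y ∈ f, y ∈ Q}))).Reachable o y
        ∨ y ∈ Xa) ∨
      (∀ y ∈ f, ¬ ((openGraph (av (insert (Sum.inl s(x, x')) ξ \ Sum.inl '' {f | ∃ y ∈ f, y ∈ Q}))).Reachable o y
        ∨ y ∈ Xa)))
    (halink : o = d ∨ o = a ∨ ∃ a₀, (∃ w : (openGraph (av (insert (Sum.inl s(x, x')) ξ))).Walk o a₀,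
      ∀ z ∈ w.support, z ∉ Q) ∧ s(a₀, a) ∈ Conn)
    (ha : (siteOpenGraph (zdGraph 3) (insert d Xa)).Reachable a d)
    (ht : (siteOpenGraph (zdGraph 3) (insert d Xb)).Reachable d t)
    (htlink : t - o ∉ box 3 r ∨ ∃ t₁, s(t, t₁) ∈ Conn ∧ ∃ v, v - o ∉ box 3 r ∧
      ∃ w : (openGraph (av (insert (Sum.inl s(x, x')) ξ))).Walk t₁ v, ∀ z ∈ w.support, z ∉ Q) :
    ∃ ξ' : Set (Sym2 (Site 3) ⊕ Site 3),
      (∀ f, (∀ y ∈ f, y - x ∉ box 3 ρ₂) → (Sum.inl f ∈ ξ' ↔ Sum.inl f ∈ ξ)) ∧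
      (∀ y, Sum.inr y ∈ ξ' ↔ Sum.inr y ∈ ξ) ∧ IsPivotal A (Sum.inr d) ξ' := by
  classical
  set e : Sym2 (Site 3) := s(x, x') with he
  set ξ' : Set (Sym2 (Site 3) ⊕ Site 3) :=
    (insert (Sum.inl e) ξ \ Sum.inl '' {f | ∃ y ∈ f, y ∈ Q}) ∪
      Sum.inl '' ({f | f ∈ (zdGraph 3).edgeSet ∧ ∀ y ∈ f, y ∈ insert d Xa} ∪
        {f | f ∈ (zdGraph 3).edgeSet ∧ ∀ y ∈ f, y ∈ insert d Xb} ∪ Conn) with hξ'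
  have hξ'E : ∀ f, Sum.inl f ∈ ξ' ↔
      (Sum.inl f ∈ insert (Sum.inl e) ξ ∧ ¬ ∃ y ∈ f, y ∈ Q) ∨
      (f ∈ (zdGraph 3).edgeSet ∧ ∀ y ∈ f, y ∈ insert d Xa) ∨
      (f ∈ (zdGraph 3).edgeSet ∧ ∀ y ∈ f, y ∈ insert d Xb) ∨ f ∈ Conn := by
    intro f
    rw [hξ', Set.mem_union, Set.mem_sdiff, Sum.inl_injective.mem_set_image,
      Sum.inl_injective.mem_set_image]
    simp only [Set.mem_union, Set.mem_setOf_eq, or_assoc]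
  have hξ'V : ∀ y, Sum.inr y ∈ ξ' ↔ Sum.inr y ∈ ξ := by
    intro y
    rw [hξ', Set.mem_union, Set.mem_sdiff]
    constructor
    · rintro (⟨hy, -⟩ | ⟨f, -, hf⟩)
      · rcases hy with h | h
        · exact absurd h Sum.inr_ne_inl
        · exact h
      · exact absurd hf Sum.inl_ne_inr
    · intro hy
      refine Or.inl ⟨Set.mem_insert_of_mem _ hy, ?_⟩
      rintro ⟨f, -, hf⟩
      exact Sum.inl_ne_inr hf
  refine ⟨ξ', fun f hf => ?_, hξ'V, ?_⟩
  · -- agreement away from `Q`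
    have hfQ : ¬ ∃ y ∈ f, y ∈ Q := fun ⟨y, hy, hyQ⟩ => hf y hy (hQx y hyQ)
    have hfe : f ≠ e := by
      rintro rfl
      exact hfQ ⟨x, Sym2.mem_mk_left x x', hxQ⟩
    rw [hξ'E]
    constructor
    · rintro (⟨hin, -⟩ | ⟨-, hX⟩ | ⟨-, hX⟩ | hC)
      · rcases hin with h | h
        · exact absurd (Sum.inl_injective h) hfe
        · exact h
      · exfalso
        induction f using Sym2.inductionOn with
        | hf u w =>
          refine hfQ ⟨u, Sym2.mem_mk_left u w, ?_⟩
          rcases hX u (Sym2.mem_mk_left u w) with rfl | h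
          · exact hdQ
          · exact hXaQ h
      · exfalso
        induction f using Sym2.inductionOn with
        | hf u w =>
          refine hfQ ⟨u, Sym2.mem_mk_left u w, ?_⟩
          rcases hX u (Sym2.mem_mk_left u w) with rfl | h
          · exact hdQ
          · exact hXbQ h
      · exact absurd (hConnQ f hC) hfQ
    · intro h
      exact Or.inl ⟨Set.mem_insert_of_mem _ h, hfQ⟩
  · -- pivotality of the mark of `d`
    rw [ProdWeight.isPivotal_iff_of_upper (isUpperSet_event hav hA)]
    refine ⟨mem_event_of_surgery hav hA hQD hdQ hXaQ hXbQ hConnav hξ'E hξ'V halink ha ht htlink, ?_⟩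
    exact not_mem_event_of_surgery hav hA hm ⟨x, Sym2.mem_mk_left x x', hxQ⟩ hdD hXab hdXb hXaQ hXbQ
      hXaN ho hConn hξ'E hξ'V

end Surgery

end UnifDim

end Summit.CriticalPhenomena.PercolationContinuityZ3.Theorems
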